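import Literature.AlgebraicGeometry.HodgeTheory.GriffithsResidueComparison
import Literature.AlgebraicGeometry.HodgeTheory.FermatEigenlineHodgeTypesViaResidues
import HarnessLib

/-!
# `Ran1980_fermatEigenspace_hodgeType_pp` and `AokiShioda1983_eigenline_le_neronSeveri` from Griffiths' residue theorem (glue)

Topic `Literature/AlgebraicGeometry/HodgeTheory`. PROOF FILE (theorems only, D-0026). The file
`FermatEigenlineHodgeTypesViaResidues` proves the two named facts
`Ran1980_fermatEigenspace_hodgeType_pp` (Ran 1980 Prop. 1.7 (ii), `(p,p)` case; file
`FermatEigenspaceHodgeTypes`) and `AokiShioda1983_eigenline_le_neronSeveri` (Aoki–Shioda 1983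
(2.1); file `FermatSurfaceNeronSeveriEigenlines`) from the residue description of one step of the
Hodge filtration of the Fermat variety, taken as explicit hypotheses
(`Ran1980_fermatEigenspace_hodgeType_pp_of_residues`, `AokiShioda1983_eigenline_le_neronSeveri_of_residues`);
the file `GriffithsResidueComparison` vendors Griffiths' theorem for all smooth hypersurfaces as
the named fact `Griffiths1969_residues_span_hodgeFiltration` (Voisin II (6.2)–(6.3), Thm. 6.5,
§6.1.3, with the naturality of the residue under the diagonal symmetries). This file plugs the
latter into the former: the Fermat form `Σ xᵢᵐ` is homogeneous of degree `m`
(`isHomogeneous_fermatPolynomial`), its gradient vanishes only at the origin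
(`exists_eval_pderiv_fermatPolynomial_ne_zero`) and `Xⁿₘ` is smooth projective
(`isSmoothProjective_fermatHypersurface`), so clauses (ii)–(iii) of the fact at pole order
`l = p + 1` (resp. `l = 1` on the surface) are the hypotheses required. Hence BOTH named facts now
rest on the single hypersurface-general fact `Griffiths1969_residues_span_hodgeFiltration`.

## References

* [Ran1980] Z. Ran, Cycles on Fermat hypersurfaces, Compositio Math. 42 (1980), §1 Prop. 1.7 (ii).
* [AokiShioda1983] N. Aoki, T. Shioda, Generators of the Néron–Severi group of a Fermat surface,
  Progr. Math. 35 (1983), §2 (2.1).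
* [VoisinHodgeII2003] C. Voisin, Hodge Theory and Complex Algebraic Geometry II, §6.1.2 Thm. 6.5, §6.1.3.
-/

noncomputable section

open CategoryTheory AlgebraicGeometry MvPolynomial

namespace Literature.AlgebraicGeometry.HodgeTheory

open Literature.AlgebraicGeometry.Motives Literature.AlgebraicTopology.SingularHomology

/-- **`Ran1980_fermatEigenspace_hodgeType_pp` from Griffiths' residue theorem**: the `(p,p)`
case of Ran's Prop. 1.7 (ii) / Shioda's (1.7) for every even-dimensional Fermat variety `X²ᵖₘ`,
granted the named fact `Griffiths1969_residues_span_hodgeFiltration` (clauses (ii)–(iii) at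
`F = Σ xᵢᵐ`, `n = 2p`, `l = p + 1`, fed to `Ran1980_fermatEigenspace_hodgeType_pp_of_residues`).
[cite: Ran1980, §1 Prop. 1.7 (ii)–(iii)] [cite: VoisinHodgeII2003, §6.1.2 Thm. 6.5 and §6.1.3] -/
theorem Ran1980_fermatEigenspace_hodgeType_pp_holds_of_griffithsResidues
    (hG : Griffiths1969_residues_span_hodgeFiltration) : Ran1980_fermatEigenspace_hodgeType_pp := by
  refine Ran1980_fermatEigenspace_hodgeType_pp_of_residues fun m _ p hp A ↦ ?_
  obtain ⟨res, -, hspan, hequiv⟩ := hG (2 * p) m (by omega) (fermatPolynomial ℂ (2 * p) m)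
    (isHomogeneous_fermatPolynomial (2 * p) m)
    (fun z hz _ ↦ exists_eval_pderiv_fermatPolynomial_ne_zero NeZero.one_le hz)
    (isSmoothProjective_fermatHypersurface (by omega) NeZero.one_le) A
  refine ⟨res (p + 1), fun x hx ↦ ?_, fun a k P hk hP ↦ ?_⟩
  · have hx' : A.pullback (2 * p) x ∈ A.hodgeFiltration (2 * p) (2 * p + 1 - (p + 1)) := by
      rwa [show 2 * p + 1 - (p + 1) = p by omega]
    exact hspan (p + 1) (by omega) (by omega) x hx'
  · exact hequiv _ (fermatGroup_le_diagonalStabilizer m a.2) (p + 1) k P (by omega) (by omega) hk hP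

/-- **`AokiShioda1983_eigenline_le_neronSeveri` from Griffiths' residue theorem**: the Hodge
eigenlines `V(β)`, `β ∈ 𝔅²ₘ`, of the Fermat surface lie in `NS(X²ₘ) ⊗ ℂ`, granted the named fact
`Griffiths1969_residues_span_hodgeFiltration` (clauses (ii)–(iii) at `F = Σᵢ₌₀³ xᵢᵐ`, `n = 2`,
`l = 1` — the holomorphic `2`-forms are the residues `Res(PΩ/F)` — fed to
`AokiShioda1983_eigenline_le_neronSeveri_of_residues`, which also uses Lefschetz `(1,1)`).
[cite: AokiShioda1983, §2 (2.1)–(2.2), p. 3] [cite: VoisinHodgeII2003, §6.1.2 Thm. 6.5 and §6.1.3] -/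
theorem AokiShioda1983_eigenline_le_neronSeveri_holds_of_griffithsResidues
    (hG : Griffiths1969_residues_span_hodgeFiltration) : AokiShioda1983_eigenline_le_neronSeveri := by
  refine AokiShioda1983_eigenline_le_neronSeveri_of_residues fun m _ A ↦ ?_
  obtain ⟨res, -, hspan, hequiv⟩ := hG 2 m (by norm_num) (fermatPolynomial ℂ 2 m)
    (isHomogeneous_fermatPolynomial 2 m)
    (fun z hz _ ↦ exists_eval_pderiv_fermatPolynomial_ne_zero NeZero.one_le hz)
    (isSmoothProjective_fermatHypersurface (by norm_num) NeZero.one_le) A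
  refine ⟨res 1, fun x hx ↦ ?_, fun a k P hk hP ↦ ?_⟩
  · exact hspan 1 le_rfl (by norm_num) x hx
  · exact hequiv _ (fermatGroup_le_diagonalStabilizer m a.2) 1 k P le_rfl (by norm_num) hk hP

end Literature.AlgebraicGeometry.HodgeTheory

end
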